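import Literature.NumberTheory.LFunctions.SuzukiSingleOperatorKernelProofs
import Mathlib.Analysis.Calculus.ParametricIntegral

/-!
# The `θ`-flow of Suzuki's kernels: `∂_θ K_θ(x) = (2π)⁻¹ ∫ L Θ_θ e^{−izx}` along `Im z = 1` (column DBR; RH-FREE)

RH-FREE throughout; nothing here bears on the truth of RH.

The kernel family of [Su20] (1.9) is `K_θ(x) = Re (2π)⁻¹ ∫_{Im z = 1} Θ_θ(z) e^{−izx} dz` with the EXPONENTIAL symbol
`Θ_θ(z) = exp(θ·L(z))`, `L(z) = −2 ξ'/ξ(½ − iz)` (the tree's `limTheta`, `limKernel`, `invFourierLine`).  Hence, for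
`θ > 1`, `θ ↦ K_θ(x)` is differentiable and its derivative is the inverse transform of `L·Θ_θ` on the same line —
the infinitesimal form of the convolution semigroup `K_{θ₁+θ₂} = K_{θ₁} ∗ K_{θ₂}` (`Theorems.SuzukiKernelSemigroup`) and
the kernel-level half of the `θ`-flow identity of the cell's crux idea `theta-flow-weil-window` (rh-dbr-idea-2;
`∂_θ K_θ = k ∗ K_θ`, `k̂ = L`):

* `hasDerivAt_limTheta` — `∂_θ Θ_θ(z) = L(z) Θ_θ(z)`;
* `norm_limTheta_le_add` — `‖Θ_θ'(z)‖ ≤ ‖Θ_{θ₁}(z)‖ + ‖Θ_{θ₂}(z)‖` for `θ₁ ≤ θ' ≤ θ₂` (monotonicity of `θ ↦ e^{−2θR}`);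
* `norm_flowSymbol_line_le` — on `Im z = 1`: `‖L(u + i)‖ ≤ 2(C + log(1 + |u|))` (the tree's vertical bound for `ξ'/ξ`
  on `Re s = 3/2`, `exists_norm_logDeriv_riemannXi_vertical_le`);
* `hasDerivAt_lineIntegral_limTheta` — differentiation under the integral sign (dominated convergence, majorant
  `const · (1 + |u|)^{−(θ+1)/2…}`): `∂_θ ∫ Θ_θ(u+i) e^{−i(u+i)x} du = ∫ L(u+i) Θ_θ(u+i) e^{−i(u+i)x} du`;
* **`hasDerivAt_limKernel`** — `HasDerivAt (θ ↦ K_θ(x)) (Re invFourierLine (L·Θ_θ) 1 x) θ` for every `θ > 1`, `x ∈ ℝ`.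

References: [Su20] M. Suzuki, ASPM 84 (2020) = arXiv:1907.07302, (1.9), Thm 1.2 (K-ii).
-/

noncomputable section

-- D-0017: `Summit.<S>.<S>.…` is the designed namespace of a single-problem summit.
set_option linter.dupNamespace false

open Complex MeasureTheory Filter Topology Set Metric

namespace Summit.RiemannHypothesis.RiemannHypothesis.Theorems.SuzukiKernelSemigroup

open Literature.NumberTheory.LFunctions

/-! ## §1 The symbol as an exponential in `θ` -/

/-- RH-FREE.  `Θ_θ(z) = exp(θ · (−2 ξ'/ξ(½ − iz)))`, written with `logDeriv`. -/
theorem limTheta_eq_cexp (θ : ℝ) (z : ℂ) :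
    limTheta θ z = Complex.exp ((θ : ℂ) * (-2 * logDeriv riemannXi (1 / 2 - I * z))) := by
  unfold limTheta
  rw [logDeriv_apply]
  congr 1
  ring

/-- RH-FREE.  `∂_θ Θ_θ(z) = L(z) Θ_θ(z)` with `L(z) = −2 ξ'/ξ(½ − iz)`. -/
theorem hasDerivAt_limTheta (z : ℂ) (θ : ℝ) :
    HasDerivAt (fun θ' : ℝ => limTheta θ' z)
      (-2 * logDeriv riemannXi (1 / 2 - I * z) * limTheta θ z) θ := by
  set c : ℂ := -2 * logDeriv riemannXi (1 / 2 - I * z) with hc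
  have h1 : HasDerivAt (fun θ' : ℝ => (θ' : ℂ) * c) ((1 : ℝ) * c) θ := by
    have h0 : HasDerivAt (fun θ' : ℝ => ((id θ' : ℝ) : ℂ)) ((1 : ℝ) : ℂ) θ := (hasDerivAt_id θ).ofReal_comp
    simpa using h0.mul_const c
  have h2 := h1.cexp
  have e : (fun θ' : ℝ => limTheta θ' z) = fun θ' : ℝ => Complex.exp ((θ' : ℂ) * c) := by
    funext θ'; rw [limTheta_eq_cexp]
  rw [e]
  convert h2 using 1
  rw [limTheta_eq_cexp, ← hc]
  push_cast
  ring

/-- RH-FREE.  `‖Θ_θ'(z)‖ ≤ ‖Θ_{θ₁}(z)‖ + ‖Θ_{θ₂}(z)‖` for `θ₁ ≤ θ' ≤ θ₂` (`‖Θ_θ(z)‖ = e^{−2θ Re ξ'/ξ(½−iz)}` is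
monotone in `θ`, in a direction set by the sign of `Re ξ'/ξ`). -/
theorem norm_limTheta_le_add {θ₁ θ' θ₂ : ℝ} (h1 : θ₁ ≤ θ') (h2 : θ' ≤ θ₂) (z : ℂ) :
    ‖limTheta θ' z‖ ≤ ‖limTheta θ₁ z‖ + ‖limTheta θ₂ z‖ := by
  rw [norm_limTheta, norm_limTheta, norm_limTheta]
  set R : ℝ := (logDeriv riemannXi (1 / 2 - I * z)).re
  rcases le_or_gt 0 R with hR | hR
  · have : Real.exp (-2 * θ' * R) ≤ Real.exp (-2 * θ₁ * R) := Real.exp_le_exp.2 (by nlinarith)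
    linarith [Real.exp_pos (-2 * θ₂ * R)]
  · have : Real.exp (-2 * θ' * R) ≤ Real.exp (-2 * θ₂ * R) := Real.exp_le_exp.2 (by nlinarith)
    linarith [Real.exp_pos (-2 * θ₁ * R)]

/-! ## §2 The generator symbol on the line `Im z = 1` -/

/-- RH-FREE.  `½ − i(u + i) = 3/2 − iu`. -/
theorem half_sub_I_mul_line_one (u : ℝ) :
    (1 : ℂ) / 2 - I * ((u : ℂ) + ((1 : ℝ) : ℂ) * I) = (((3 / 2 : ℝ)) : ℂ) + ((-u : ℝ) : ℂ) * I := by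
  push_cast
  linear_combination (-1 : ℂ) * I_mul_I

/-- RH-FREE.  The generator symbol is continuous along `Im z = 1` (`ξ'/ξ` is continuous on `Re s = 3/2`). -/
theorem continuous_flowSymbol_line :
    Continuous fun u : ℝ => -2 * logDeriv riemannXi (1 / 2 - I * ((u : ℂ) + ((1 : ℝ) : ℂ) * I)) := by
  have h := (continuous_logDeriv_riemannXi_vertical (c := 3 / 2) (by norm_num)).comp continuous_neg
  have e : (fun u : ℝ => logDeriv riemannXi (1 / 2 - I * ((u : ℂ) + ((1 : ℝ) : ℂ) * I))) =
      fun u : ℝ => logDeriv riemannXi ((((3 / 2 : ℝ)) : ℂ) + ((-u : ℝ) : ℂ) * I) := by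
    funext u; rw [half_sub_I_mul_line_one]
  have h' : Continuous fun u : ℝ => logDeriv riemannXi (1 / 2 - I * ((u : ℂ) + ((1 : ℝ) : ℂ) * I)) := by
    rw [e]; exact h
  exact continuous_const.mul h'

/-- RH-FREE.  **Logarithmic growth of the generator on `Im z = 1`**: there is `C ≥ 0` with
`‖−2 ξ'/ξ(½ − i(u+i))‖ ≤ 2 (C + log(1 + |u|))` for all real `u` (the tree's bound for `ξ'/ξ` on `Re s = 3/2`). -/
theorem norm_flowSymbol_line_le :
    ∃ C : ℝ, 0 ≤ C ∧ ∀ u : ℝ,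
      ‖-2 * logDeriv riemannXi (1 / 2 - I * ((u : ℂ) + ((1 : ℝ) : ℂ) * I))‖ ≤ 2 * (C + Real.log (1 + |u|)) := by
  obtain ⟨C, hC⟩ := exists_norm_logDeriv_riemannXi_vertical_le
  refine ⟨max C 0, le_max_right _ _, fun u => ?_⟩
  rw [half_sub_I_mul_line_one, norm_mul]
  have h := hC (-u)
  rw [abs_neg] at h
  have h2 : ‖(-2 : ℂ)‖ = 2 := by simp
  rw [h2]
  have hlog : 0 ≤ Real.log (1 + |u|) := Real.log_nonneg (by linarith [abs_nonneg u])
  nlinarith [le_max_left C 0, norm_nonneg (logDeriv riemannXi ((((3 / 2 : ℝ)) : ℂ) + ((-u : ℝ) : ℂ) * I))]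

/-! ## §3 Differentiation under the integral sign -/

/-- RH-FREE.  `‖e^{−i(u+i)x}‖ = eˣ`. -/
theorem norm_cexp_line_one (u x : ℝ) :
    ‖Complex.exp (-I * ((u : ℂ) + ((1 : ℝ) : ℂ) * I) * (x : ℂ))‖ = Real.exp x := by
  rw [Complex.norm_exp]
  congr 1
  simp only [neg_mul, mul_re, neg_re, mul_im, I_re, I_im, add_re, add_im, ofReal_re, ofReal_im,
    mul_zero, mul_one, zero_mul, one_mul, zero_add, add_zero, sub_zero, zero_sub]
  ring

/-- RH-FREE.  An integrable majorant of `(C + log(1+|u|))·(1+|u|)^{−θ₁}` for `θ₁ > 1`: with `ε = (θ₁−1)/2`,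
`(C + log(1+|u|))(1+|u|)^{−θ₁} ≤ (C + 1/ε)(1+|u|)^{−(θ₁−ε)}` (`log y ≤ y^ε/ε`), and `θ₁ − ε > 1`. -/
theorem log_mul_rpow_le {C θ₁ : ℝ} (hC : 0 ≤ C) (hθ₁ : 1 < θ₁) (u : ℝ) :
    (C + Real.log (1 + |u|)) * (1 + |u|) ^ (-θ₁) ≤
      (C + 1 / ((θ₁ - 1) / 2)) * (1 + |u|) ^ (-(θ₁ - (θ₁ - 1) / 2)) := by
  set ε : ℝ := (θ₁ - 1) / 2 with hε
  have hε0 : 0 < ε := by rw [hε]; linarith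
  have hy : 1 ≤ 1 + |u| := by linarith [abs_nonneg u]
  have hy0 : 0 < 1 + |u| := by linarith
  have hlog : Real.log (1 + |u|) ≤ (1 + |u|) ^ ε / ε := Real.log_le_rpow_div hy0.le hε0
  have hpow1 : 1 ≤ (1 + |u|) ^ ε := Real.one_le_rpow hy hε0.le
  have hsplit : (1 + |u|) ^ (-(θ₁ - ε)) = (1 + |u|) ^ ε * (1 + |u|) ^ (-θ₁) := by
    rw [← Real.rpow_add hy0]; congr 1; ring
  rw [hsplit]
  have hnn : 0 ≤ (1 + |u|) ^ (-θ₁) := Real.rpow_nonneg hy0.le _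
  have key : C + Real.log (1 + |u|) ≤ (C + 1 / ε) * (1 + |u|) ^ ε := by
    have : C ≤ C * (1 + |u|) ^ ε := by nlinarith
    have : (1 + |u|) ^ ε / ε = 1 / ε * (1 + |u|) ^ ε := by ring
    nlinarith
  calc (C + Real.log (1 + |u|)) * (1 + |u|) ^ (-θ₁)
      ≤ ((C + 1 / ε) * (1 + |u|) ^ ε) * (1 + |u|) ^ (-θ₁) := mul_le_mul_of_nonneg_right key hnn
    _ = (C + 1 / ε) * ((1 + |u|) ^ ε * (1 + |u|) ^ (-θ₁)) := by ring

/-- RH-FREE.  `u ↦ (1 + |u|)^{−r}` is integrable on `ℝ` for `r > 1`. -/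
theorem integrable_one_add_abs_rpow_neg' {r : ℝ} (hr : 1 < r) :
    Integrable fun u : ℝ => (1 + |u|) ^ (-r) := by
  have h := integrable_one_add_norm (E := ℝ) (μ := volume) (r := r) (by simpa using hr)
  simpa [Real.norm_eq_abs] using h

/-- **RH-FREE · differentiation under the integral sign along `Im z = 1`**: for `θ > 1` and real `x`,
`θ' ↦ ∫ Θ_θ'(u+i) e^{−i(u+i)x} du` has derivative `∫ L(u+i) Θ_θ(u+i) e^{−i(u+i)x} du` at `θ`
(`L = −2ξ'/ξ(½ − i·)`), and the latter integrand is integrable. -/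
theorem hasDerivAt_lineIntegral_limTheta {θ : ℝ} (hθ : 1 < θ) (x : ℝ) :
    Integrable (fun u : ℝ => -2 * logDeriv riemannXi (1 / 2 - I * ((u : ℂ) + ((1 : ℝ) : ℂ) * I)) *
        limTheta θ ((u : ℂ) + ((1 : ℝ) : ℂ) * I) * Complex.exp (-I * ((u : ℂ) + ((1 : ℝ) : ℂ) * I) * (x : ℂ))) ∧
    HasDerivAt (fun θ' : ℝ => ∫ u : ℝ, limTheta θ' ((u : ℂ) + ((1 : ℝ) : ℂ) * I) *
        Complex.exp (-I * ((u : ℂ) + ((1 : ℝ) : ℂ) * I) * (x : ℂ)))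
      (∫ u : ℝ, -2 * logDeriv riemannXi (1 / 2 - I * ((u : ℂ) + ((1 : ℝ) : ℂ) * I)) *
        limTheta θ ((u : ℂ) + ((1 : ℝ) : ℂ) * I) * Complex.exp (-I * ((u : ℂ) + ((1 : ℝ) : ℂ) * I) * (x : ℂ))) θ := by
  -- the window of parameters `|θ' − θ| < δ`, `θ − δ > 1`
  set δ : ℝ := (θ - 1) / 2 with hδ
  have hδ0 : 0 < δ := by rw [hδ]; linarith
  set θ₁ : ℝ := θ - δ with hθ₁
  set θ₂ : ℝ := θ + δ with hθ₂
  have hθ₁1 : 1 < θ₁ := by rw [hθ₁, hδ]; linarith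
  -- notation
  set E : ℝ → ℂ := fun u => Complex.exp (-I * ((u : ℂ) + ((1 : ℝ) : ℂ) * I) * (x : ℂ)) with hE
  set Lsym : ℝ → ℂ := fun u => -2 * logDeriv riemannXi (1 / 2 - I * ((u : ℂ) + ((1 : ℝ) : ℂ) * I)) with hL
  set F : ℝ → ℝ → ℂ := fun θ' u => limTheta θ' ((u : ℂ) + ((1 : ℝ) : ℂ) * I) * E u with hF
  set F' : ℝ → ℝ → ℂ := fun θ' u => Lsym u * limTheta θ' ((u : ℂ) + ((1 : ℝ) : ℂ) * I) * E u with hF'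
  have hEc : Continuous E := by rw [hE]; fun_prop
  have hEn : ∀ u, ‖E u‖ = Real.exp x := fun u => by rw [hE]; exact norm_cexp_line_one u x
  -- measurability
  have hF_meas : ∀ θ' : ℝ, AEStronglyMeasurable (F θ') volume := fun θ' =>
    ((continuous_limTheta_line θ' (b := 1) (by norm_num)).mul hEc).aestronglyMeasurable
  have hF'_cont : Continuous (F' θ) :=
    (continuous_flowSymbol_line.mul (continuous_limTheta_line θ (b := 1) (by norm_num))).mul hEc
  -- integrability at θ
  have hF_int : Integrable (F θ) := integrable_limTheta_lineIntegrand hθ (b := 1) (by norm_num) x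
  -- the majorant
  obtain ⟨C, hC0, hC⟩ := norm_flowSymbol_line_le
  obtain ⟨C₁, hC₁0, hC₁⟩ := norm_limTheta_line_le (θ := θ₁) (by linarith) (b₀ := 1) (by norm_num)
  obtain ⟨C₂, hC₂0, hC₂⟩ := norm_limTheta_line_le (θ := θ₂) (by linarith) (b₀ := 1) (by norm_num)
  set r : ℝ := θ₁ - (θ₁ - 1) / 2 with hr
  have hr1 : 1 < r := by rw [hr]; linarith
  set bound : ℝ → ℝ := fun u =>
    2 * ((C + 1 / ((θ₁ - 1) / 2)) * (1 + |u|) ^ (-r)) * (C₁ + C₂) * Real.exp x with hbound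
  have hbound_int : Integrable bound := by
    rw [hbound]
    exact (((integrable_one_add_abs_rpow_neg' hr1).const_mul _).const_mul 2 |>.mul_const _).mul_const _
  have h_bound : ∀ᵐ u : ℝ ∂volume, ∀ θ' ∈ ball θ δ, ‖F' θ' u‖ ≤ bound u := by
    refine Eventually.of_forall fun u θ' hθ' => ?_
    have hθ'1 : θ₁ ≤ θ' := by
      have := (abs_lt.1 (mem_ball.1 hθ')).1; rw [hθ₁]; linarith
    have hθ'2 : θ' ≤ θ₂ := by
      have := (abs_lt.1 (mem_ball.1 hθ')).2; rw [hθ₂]; linarith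
    have hy0 : 0 < 1 + |u| := by linarith [abs_nonneg u]
    have hΘ : ‖limTheta θ' ((u : ℂ) + ((1 : ℝ) : ℂ) * I)‖ ≤ (C₁ + C₂) * (1 + |u|) ^ (-θ₁) := by
      refine (norm_limTheta_le_add hθ'1 hθ'2 _).trans ?_
      have e1 := hC₁ 1 le_rfl u
      have e2 := hC₂ 1 le_rfl u
      have hmono : (1 + |u|) ^ (-θ₂) ≤ (1 + |u|) ^ (-θ₁) :=
        Real.rpow_le_rpow_of_exponent_le (by linarith [abs_nonneg u]) (by rw [hθ₁, hθ₂]; linarith)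
      nlinarith [Real.rpow_nonneg hy0.le (-θ₁)]
    have hLu := hC u
    have hlog := log_mul_rpow_le hC0 hθ₁1 u
    rw [hF']
    simp only [norm_mul, hEn]
    have hnn1 : 0 ≤ ‖Lsym u‖ := norm_nonneg _
    have hnn2 : 0 ≤ (1 + |u|) ^ (-θ₁) := Real.rpow_nonneg hy0.le _
    have hlog0 : 0 ≤ Real.log (1 + |u|) := Real.log_nonneg (by linarith [abs_nonneg u])
    calc ‖Lsym u‖ * ‖limTheta θ' ((u : ℂ) + ((1 : ℝ) : ℂ) * I)‖ * Real.exp x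
        ≤ (2 * (C + Real.log (1 + |u|))) * ((C₁ + C₂) * (1 + |u|) ^ (-θ₁)) * Real.exp x := by
          gcongr
      _ = 2 * ((C + Real.log (1 + |u|)) * (1 + |u|) ^ (-θ₁)) * (C₁ + C₂) * Real.exp x := by ring
      _ ≤ 2 * ((C + 1 / ((θ₁ - 1) / 2)) * (1 + |u|) ^ (-r)) * (C₁ + C₂) * Real.exp x := by
          rw [hr]
          gcongr
  -- pointwise differentiability in θ'
  have h_diff : ∀ᵐ u : ℝ ∂volume, ∀ θ' ∈ ball θ δ, HasDerivAt (fun θ'' => F θ'' u) (F' θ' u) θ' := by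
    refine Eventually.of_forall fun u θ' _ => ?_
    have h := (hasDerivAt_limTheta ((u : ℂ) + ((1 : ℝ) : ℂ) * I) θ').mul_const (E u)
    rw [hF', hF]
    exact h
  have hmain := hasDerivAt_integral_of_dominated_loc_of_deriv_le (ball_mem_nhds θ hδ0)
    (Eventually.of_forall hF_meas) hF_int hF'_cont.aestronglyMeasurable h_bound hbound_int h_diff
  exact hmain

/-! ## §4 The `θ`-derivative of `K_θ(x)` -/

/-- **RH-FREE · THE `θ`-FLOW OF SUZUKI'S KERNELS (kernel level)**: for `θ > 1` and every real `x`,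
`θ' ↦ K_θ'(x)` is differentiable at `θ` with derivative
`Re (2π)⁻¹ ∫_{Im z = 1} (−2ξ'/ξ(½ − iz)) Θ_θ(z) e^{−izx} dz = Re invFourierLine (L·Θ_θ) 1 x`
— the inverse transform, on the same line, of the generator `L` times the symbol.  Nothing here bears on RH. -/
theorem hasDerivAt_limKernel {θ : ℝ} (hθ : 1 < θ) (x : ℝ) :
    HasDerivAt (fun θ' : ℝ => limKernel θ' x)
      ((invFourierLine (fun z : ℂ => -2 * logDeriv riemannXi (1 / 2 - I * z) * limTheta θ z) 1 x).re) θ := by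
  have h := (hasDerivAt_lineIntegral_limTheta hθ x).2
  have hc := h.const_mul ((1 : ℂ) / (2 * (Real.pi : ℂ)))
  have hre := Complex.reCLM.hasFDerivAt.comp_hasDerivAt θ hc
  have e1 : (fun θ' : ℝ => limKernel θ' x) = (Complex.reCLM : ℂ → ℝ) ∘ fun θ' : ℝ =>
      (1 : ℂ) / (2 * (Real.pi : ℂ)) * ∫ u : ℝ, limTheta θ' ((u : ℂ) + ((1 : ℝ) : ℂ) * I) *
        Complex.exp (-I * ((u : ℂ) + ((1 : ℝ) : ℂ) * I) * (x : ℂ)) := by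
    funext θ'
    rfl
  have hval : Complex.reCLM ((1 : ℂ) / (2 * (Real.pi : ℂ)) * ∫ u : ℝ,
      -2 * logDeriv riemannXi (1 / 2 - I * ((u : ℂ) + ((1 : ℝ) : ℂ) * I)) *
        limTheta θ ((u : ℂ) + ((1 : ℝ) : ℂ) * I) * Complex.exp (-I * ((u : ℂ) + ((1 : ℝ) : ℂ) * I) * (x : ℂ))) =
      (invFourierLine (fun z : ℂ => -2 * logDeriv riemannXi (1 / 2 - I * z) * limTheta θ z) 1 x).re := by
    rw [Complex.reCLM_apply]
    unfold invFourierLine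
    congr 2
  rw [e1, ← hval]
  exact hre

end Summit.RiemannHypothesis.RiemannHypothesis.Theorems.SuzukiKernelSemigroup

end
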